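import Summits.RiemannHypothesis.RiemannHypothesis.Theorems.RuelleBandCofiniteCriticalLineStubCalibrationENDOfRHAux
import Summits.RiemannHypothesis.RiemannHypothesis.Theorems.RuelleBandCofiniteCriticalLineStubCalibrationENDOfRHAux2
import Summits.RiemannHypothesis.RiemannHypothesis.Theorems.RuelleBandCofiniteCriticalLineStubZeroLevelNullVectorAux
import Summits.RiemannHypothesis.RiemannHypothesis.Theorems.RuelleBandCofiniteCriticalLineStubCofiniteWeilCriterion
import HarnessLib

set_option linter.dupNamespace false

/-!
# Calibration stub `stub_calibration_END_of_RH` of line `cofinite-weil-index-staircase`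
(crux `Summit.RiemannHypothesis.RiemannHypothesis.Theses.RuelleBand.CofiniteCriticalLine`,
item stmt-RiemannHypothesis-2064)

The line's BET `stub_eventuallyNondegenerate` says that for all large windows `a` the closed Weil
form on `[-a, a]` has no non-zero NULL VECTOR: no `u ∈ L²`, `u ≠ 0` a.e., that is an `L²`- and
form-Cauchy limit of window test functions `gₙ` with `W(gₙ ⋆ h̃) → 0` for every window test `h`.
This file certifies that the bet is RH-IMPLIED AS TYPED, for EVERY window `a > 0`
(`stub_calibration_END_of_RH`, documentation for the planners; not part of the composition).

Proof (`Q = weilQuadratic`, `W = weilFunctional`, `ĝ = weilMellin g`):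

* (G1) RH ⇒ `Re Q ≥ 0` on test functions (`WeilPositivity.of_riemannHypothesis`,
  `explicit_formula_holds`).
* (G2) `Re Q(gₙ) → 0`: `Re Q(gₙ − gₘ) = Re Q(gₙ) + Re Q(gₘ) − 2 Re W(gₙ ⋆ g̃ₘ)` (sesquilinearity
  and Hermitian symmetry, landed `stub_zeroLevelNullVector_B_*`); fix `m` large and let `n → ∞`.
* (G3) under RH the zero side is `Q(g) = Σ_ρ m(ρ)|ĝ(ρ)|²` (`stub_cofiniteWeilCriterion_zeroForm_eq`,
  `1 − ρ̄ = ρ`), so `|ĝₙ(ρ)|² ≤ Re Q(gₙ) → 0` at every non-trivial zero `ρ`.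
* (G4) `ĝₙ(ρ) → û(ρ)` (Cauchy–Schwarz on the window, Aux file 1), hence `û(ρ) = 0`.
* (G5) `û` is entire with `|û(s)| ≤ ‖u‖₁ e^{a|Re s − 1/2|}` (Aux file 1); such a function vanishing
  at all non-trivial zeros is `≡ 0` under RH (Jensen + Montgomery's `N_d(T) ≥ (5/6 − ε) N(T)` +
  Riemann–von Mangoldt; Aux file 2, `stub_calibration_END_of_RH_entire_eq_zero`).
* (G6) `û ≡ 0` ⇒ `u = 0` a.e. (Plancherel for `L¹ ∩ L²`; Aux file 1,
  `stub_calibration_END_of_RH_ae_eq_zero_of_weilMellin_eq_zero`) — contradiction.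
-/

noncomputable section

open Complex MeasureTheory Filter Set
open scoped BigOperators Topology ComplexConjugate

namespace Summit.RiemannHypothesis.RiemannHypothesis.Theorems.RuelleBandCofiniteCriticalLine

open Literature.NumberTheory.LFunctions

/-! ### (G2) The Cauchy argument: `Q(gₙ) → 0` -/

section Cauchy

variable {f h : ℝ → ℂ}

/-- **Expansion of the form over a difference, real part**:
`Re Q(f − h) = Re Q(f) + Re Q(h) − 2 Re W(f ⋆ h̃)` for test functions (polarisation
`weilQuadratic_add`, homogeneity, and the Hermitian symmetry
`stub_zeroLevelNullVector_B_conj_symm`). [folklore] -/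
theorem stub_calibration_END_of_RH_re_weilQuadratic_sub (hf : IsWeilTest f) (hh : IsWeilTest h) :
    (weilQuadratic (f - h)).re = (weilQuadratic f).re + (weilQuadratic h).re -
      2 * (weilFunctional (weilConv f (weilReflect h))).re := by
  have hh' : IsWeilTest ((-1 : ℂ) • h) := hh.const_mul (-1)
  have e : f - h = f + (-1 : ℂ) • h := by
    funext t; simp [sub_eq_add_neg]
  have hQ := weilQuadratic_add hf hh'
  rw [stub_zeroLevelNullVector_B_smul_right, stub_zeroLevelNullVector_B_smul_left] at hQ
  have hc : weilQuadratic ((-1 : ℂ) • h) = weilQuadratic h := by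
    rw [show ((-1 : ℂ) • h) = fun t => (-1 : ℂ) * h t from rfl, weilQuadratic_const_mul]
    simp
  have hsymm : (weilFunctional (weilConv h (weilReflect f))).re =
      (weilFunctional (weilConv f (weilReflect h))).re := by
    rw [← stub_zeroLevelNullVector_B_conj_symm hf hh, Complex.conj_re]
  rw [e, hQ, hc]
  simp only [Complex.add_re, Complex.mul_re, map_neg, map_one, Complex.neg_re, Complex.neg_im,
    Complex.one_re, Complex.one_im, hsymm]
  ring

/-- **`Q(gₙ) → 0` for a form-Cauchy sequence orthogonal in the limit to itself**: if
`Re Q(gₙ) ≥ 0`, `Re Q(gₙ − gₘ) → 0` on `ℕ × ℕ` and `W(gₙ ⋆ g̃ₘ) → 0` as `n → ∞` for each `m`, then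
`Re Q(gₙ) → 0` (fix `m` large, let `n → ∞` in
`Re Q(gₙ) = Re Q(gₙ − gₘ) − Re Q(gₘ) + 2 Re W(gₙ ⋆ g̃ₘ)`). [folklore] -/
theorem stub_calibration_END_of_RH_tendsto_re_weilQuadratic {g : ℕ → ℝ → ℂ}
    (hg : ∀ n, IsWeilTest (g n)) (hpos : ∀ n, 0 ≤ (weilQuadratic (g n)).re)
    (hC : Tendsto (fun q : ℕ × ℕ => (weilQuadratic (g q.1 - g q.2)).re) atTop (𝓝 0))
    (hW : ∀ m, Tendsto (fun n => weilFunctional (weilConv (g n) (weilReflect (g m))))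
      atTop (𝓝 0)) :
    Tendsto (fun n => (weilQuadratic (g n)).re) atTop (𝓝 0) := by
  rw [Metric.tendsto_atTop]
  intro ε hε
  have h1 : ∀ᶠ q : ℕ × ℕ in atTop, |(weilQuadratic (g q.1 - g q.2)).re| < ε / 3 := by
    have := (Metric.tendsto_nhds.1 hC) (ε / 3) (by positivity)
    simpa [Real.dist_eq] using this
  obtain ⟨M, hM⟩ := eventually_atTop_prod_self.1 h1
  obtain ⟨N, hN⟩ := (Metric.tendsto_atTop.1 (hW M)) (ε / 3) (by positivity)
  refine ⟨max M N, fun n hn => ?_⟩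
  have hnM : M ≤ n := le_of_max_le_left hn
  have hnN : N ≤ n := le_of_max_le_right hn
  have hq : |(weilQuadratic (g n - g M)).re| < ε / 3 := hM n M hnM le_rfl
  have hb := hN n hnN
  rw [dist_zero_right] at hb
  have hbre : |(weilFunctional (weilConv (g n) (weilReflect (g M)))).re| < ε / 3 :=
    (abs_re_le_norm _).trans_lt hb
  have hexp := stub_calibration_END_of_RH_re_weilQuadratic_sub (hg n) (hg M)
  rw [Real.dist_eq, sub_zero, abs_of_nonneg (hpos n)]
  have hM0 := hpos M
  linarith [(abs_lt.1 hq).2, (abs_lt.1 hbre).2]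

end Cauchy

/-! ### (G3) The zero side under RH: `|ĝ(ρ)|² ≤ Re Q(g)` -/

/-- **Termwise bound on the zero side (RH).** For a test function `g` and a non-trivial zero
`ρ₀`: `‖ĝ(ρ₀)‖² ≤ Re Q(g)`. Indeed `Q(g) = Σ_ρ m(ρ) ĝ(ρ) conj ĝ(1 − ρ̄)`
(`stub_cofiniteWeilCriterion_zeroForm_eq`, absolutely convergent), and under RH `1 − ρ̄ = ρ`, so
every term is `m(ρ)|ĝ(ρ)|² ≥ 0`, with `m(ρ₀) ≥ 1` (Bombieri 2000 §3, (3.2)). [folklore] -/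
theorem stub_calibration_END_of_RH_norm_sq_weilMellin_le (hRH : RiemannHypothesis) {g : ℝ → ℂ}
    (hg : IsWeilTest g) {ρ₀ : ℂ} (hρ₀ : ρ₀ ∈ ZetaZeros.riemannZetaNontrivialZeros) :
    ‖weilMellin g ρ₀‖ ^ 2 ≤ (weilQuadratic g).re := by
  set G : ZetaZeros.riemannZetaNontrivialZeros → ℝ := fun ρ =>
    (riemannZetaZeroOrder (ρ : ℂ) : ℝ) * ‖weilMellin g ρ‖ ^ 2 with hG
  have hG0 : ∀ ρ, 0 ≤ G ρ := fun ρ => mul_nonneg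
    (by exact_mod_cast (le_trans zero_le_one
      (ZetaZeros.riemannZetaNontrivialZeros.one_le_order ρ.2))) (sq_nonneg _)
  have hterm : ∀ ρ : ZetaZeros.riemannZetaNontrivialZeros,
      (riemannZetaZeroOrder (ρ : ℂ) : ℂ) * WeilConverse.pairCoeff g ρ = (G ρ : ℂ) := by
    intro ρ
    have hre : (ρ : ℂ).re = 1 / 2 :=
      hRH ρ (ZetaZeros.riemannZetaNontrivialZeros.zeta_eq_zero ρ.2)
        (by rintro ⟨n, hn⟩; exact ρ.2.2 ⟨n, hn.symm⟩)
        (ZetaZeros.riemannZetaNontrivialZeros.ne_one ρ.2)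
    have h1 : 1 - conj (ρ : ℂ) = ρ := by
      apply Complex.ext
      · simp only [sub_re, one_re, conj_re, hre]; norm_num
      · simp
    rw [WeilConverse.pairCoeff, h1, Complex.mul_conj, Complex.normSq_eq_norm_sq, hG]
    push_cast
    ring
  have hnorm : ∀ ρ : ZetaZeros.riemannZetaNontrivialZeros,
      ‖(riemannZetaZeroOrder (ρ : ℂ) : ℂ) * WeilConverse.pairCoeff g ρ‖ = G ρ := by
    intro ρ
    rw [hterm, Complex.norm_real, Real.norm_of_nonneg (hG0 ρ)]
  have hsum : Summable G := (WeilConverse.summable_norm_pairCoeff hg).congr hnorm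
  have hzf : WeilConverse.zeroForm g = ((∑' ρ, G ρ : ℝ) : ℂ) := by
    rw [WeilConverse.zeroForm, Complex.ofReal_tsum]
    exact tsum_congr hterm
  have hre : (weilQuadratic g).re = ∑' ρ, G ρ := by
    rw [← stub_cofiniteWeilCriterion_zeroForm_eq hg, hzf, Complex.ofReal_re]
  rw [hre]
  have hle : G ⟨ρ₀, hρ₀⟩ ≤ ∑' ρ, G ρ := hsum.le_tsum _ (fun ρ _ => hG0 ρ)
  refine le_trans ?_ hle
  have hm : (1 : ℝ) ≤ riemannZetaZeroOrder ρ₀ := by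
    exact_mod_cast ZetaZeros.riemannZetaNontrivialZeros.one_le_order hρ₀
  have h0 : 0 ≤ ‖weilMellin g ρ₀‖ ^ 2 := sq_nonneg _
  show ‖weilMellin g ρ₀‖ ^ 2 ≤ (riemannZetaZeroOrder ρ₀ : ℝ) * ‖weilMellin g ρ₀‖ ^ 2
  nlinarith

/-! ### The calibration stub -/

/-- **Calibration stub — the bet `stub_eventuallyNondegenerate` is RH-implied AS TYPED, for every
window `a > 0`.** Under RH, `Q ≥ 0` (`WeilPositivity.of_riemannHypothesis`); a null vector `u`
with its `L²`- and form-Cauchy approximants `gₙ` (`W(gₙ ⋆ h̃) → 0` on the window core) has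
`Q(gₙ) → 0` (`stub_calibration_END_of_RH_tendsto_re_weilQuadratic`), hence
`|ĝₙ(ρ)|² ≤ Re Q(gₙ) → 0` at every non-trivial zero (`…_norm_sq_weilMellin_le`), so
`û(ρ) = lim ĝₙ(ρ) = 0` (`…_tendsto_weilMellin`); `û` is entire with
`|û(s)| ≤ ‖u‖₁ e^{a|Re s − 1/2|}` (`…_differentiable_weilMellin`, `…_norm_weilMellin_le`), and such a
function vanishing at all non-trivial zeros is `≡ 0` (Jensen + Montgomery's `N_d ≥ (5/6 − ε)N` on RH
+ Riemann–von Mangoldt, `…_entire_eq_zero`); finally `û ≡ 0` forces `u = 0` a.e. (Plancherel,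
`…_ae_eq_zero_of_weilMellin_eq_zero`) — contradicting `u ≠ 0`. [folklore] -/
theorem stub_calibration_END_of_RH : RiemannHypothesis →
    ∀ a : ℝ, 0 < a →
      ¬ ∃ (u : ℝ → ℂ) (g : ℕ → ℝ → ℂ), MemLp u 2 volume ∧ ¬ (u =ᵐ[volume] 0) ∧
          (∀ n, IsWeilTest (g n) ∧ tsupport (g n) ⊆ Set.Icc (-a) a) ∧
          Tendsto (fun n => ∫ t, ‖g n t - u t‖ ^ 2) atTop (𝓝 0) ∧
          Tendsto (fun q : ℕ × ℕ => (weilQuadratic (g q.1 - g q.2)).re) atTop (𝓝 0) ∧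
          ∀ h : ℝ → ℂ, IsWeilTest h → tsupport h ⊆ Set.Icc (-a) a →
            Tendsto (fun n => weilFunctional (weilConv (g n) (weilReflect h))) atTop (𝓝 0) := by
  intro hRH a ha
  rintro ⟨u, g, hu, hu0, hg, hL2, hC, hW⟩
  -- (G1) positivity under RH
  have hpos : ∀ n, 0 ≤ (weilQuadratic (g n)).re := fun n =>
    WeilPositivity.of_riemannHypothesis explicit_formula_holds hRH (g n) (hg n).1
  -- (G2) `Q(gₙ) → 0`
  have hQ : Tendsto (fun n => (weilQuadratic (g n)).re) atTop (𝓝 0) :=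
    stub_calibration_END_of_RH_tendsto_re_weilQuadratic (fun n => (hg n).1) hpos hC
      (fun m => hW (g m) (hg m).1 (hg m).2)
  -- localisation of `u`
  have hz : ∀ᵐ t : ℝ, t ∉ Icc (-a) a → u t = 0 :=
    stub_calibration_END_of_RH_ae_zero_off hu hg hL2
  -- (G3)+(G4): `û` vanishes at every non-trivial zero
  have hzero : ∀ ρ ∈ ZetaZeros.riemannZetaNontrivialZeros, weilMellin u ρ = 0 := by
    intro ρ hρ
    have hlim : Tendsto (fun n => weilMellin (g n) ρ) atTop (𝓝 (weilMellin u ρ)) :=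
      stub_calibration_END_of_RH_tendsto_weilMellin hu hz hg hL2 ρ
    have hlim0 : Tendsto (fun n => weilMellin (g n) ρ) atTop (𝓝 0) := by
      rw [tendsto_zero_iff_norm_tendsto_zero]
      have hb : ∀ n, ‖weilMellin (g n) ρ‖ ≤ Real.sqrt ((weilQuadratic (g n)).re) := fun n => by
        simpa only [abs_norm] using
          Real.abs_le_sqrt (stub_calibration_END_of_RH_norm_sq_weilMellin_le hRH (hg n).1 hρ)
      refine squeeze_zero (fun n => norm_nonneg _) hb ?_
      simpa using hQ.sqrt
    exact tendsto_nhds_unique hlim hlim0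
  -- (G5) `û ≡ 0`
  have hent := stub_calibration_END_of_RH_entire_eq_zero hRH
    (stub_calibration_END_of_RH_differentiable_weilMellin hu hz) ha.le
    (stub_calibration_END_of_RH_norm_weilMellin_le hu hz) hzero
  -- (G6) `u = 0` a.e.
  exact hu0 (stub_calibration_END_of_RH_ae_eq_zero_of_weilMellin_eq_zero hu hz hent)

end Summit.RiemannHypothesis.RiemannHypothesis.Theorems.RuelleBandCofiniteCriticalLine

end
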